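import Mathlib.GroupTheory.Index
import Mathlib.GroupTheory.GroupAction.Basic
import HarnessLib

/-!
# The index count in the proof of [SemiAnbd] Proposition 2.6 (edge case, p. 29)

Mochizuki, *Semi-graphs of anabelioids*, Publ. RIMS **42** (2006) 221–322, §2, proof of
Proposition 2.6, p. 29 [cite: MochizukiSemiAnbd2006, Prop. 2.6 p.29]: "set
`M := [Π_ℍ : Π_𝕂 ∩ Π_ℍ] + 1` … a finite graph-covering of degree `M` … which is trivial over `𝕂`,
but connected over `L`.  Then considering the actions of `Π_ℍ`, `Π_𝕂` on the corresponding
finite `Π_𝒢`-set yields a contradiction."  The contradiction is the following elementary count,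
isolated here as a Mathlib-level lemma: if for every `M` there is a finite `G`-set `S` with more
than `M` points on which the subgroup `H` acts TRANSITIVELY and the subgroup `K` acts TRIVIALLY,
then `K ∩ H` has infinite index in `H` (`K.relIndex H = 0`): the stabiliser in `H` of a point has
index `|S|` (orbit–stabiliser) and contains `K ∩ H`.  Proof-only, no definitions.
-/

namespace Literature.AnabelianGeometry.SemiGraphs

open MulAction

universe u v

/-- **Transitive versus trivial actions force infinite index** ([SemiAnbd] p. 29): if for every
`M` some finite `G`-set with more than `M` points is acted on transitively by `H` and trivially by
`K`, then `[H : K ∩ H] = ∞`, i.e. `K.relIndex H = 0`. [cite: MochizukiSemiAnbd2006, Prop. 2.6 p.29] -/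
theorem relIndex_eq_zero_of_transitive_of_trivial {G : Type u} [Group G] (H K : Subgroup G)
    (h : ∀ M : ℕ, ∃ (S : Type v) (_ : MulAction G S), Finite S ∧ M < Nat.card S ∧
      (∀ s t : S, ∃ g ∈ H, g • s = t) ∧ ∀ k ∈ K, ∀ s : S, k • s = s) :
    K.relIndex H = 0 := by
  by_contra hn
  obtain ⟨S, _, hfin, hcard, htrans, htriv⟩ := h (K.relIndex H)
  haveI := hfin
  -- a point of `S` (there is one: `|S| > [H : K ∩ H] ≥ 1`)
  have hne : Nonempty S := by
    by_contra hS
    rw [not_nonempty_iff] at hS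
    rw [Nat.card_of_isEmpty] at hcard
    exact Nat.not_lt_zero _ hcard
  obtain ⟨s⟩ := hne
  -- `H` acts transitively on `S`
  haveI : IsPretransitive H S := ⟨fun x y => by
    obtain ⟨g, hg, hgs⟩ := htrans x y
    exact ⟨⟨g, hg⟩, hgs⟩⟩
  -- `K ∩ H ≤ Stab_H(s)`, whose index in `H` is `|S|`
  have hle : K.subgroupOf H ≤ stabilizer H s := by
    intro k hk
    exact htriv k.1 (Subgroup.mem_subgroupOf.mp hk) s
  have hdvd : Nat.card S ∣ K.relIndex H := by
    rw [← index_stabilizer_of_transitive H s]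
    exact Subgroup.index_dvd_of_le hle
  exact absurd (Nat.le_of_dvd (Nat.pos_of_ne_zero hn) hdvd) (not_le.mpr hcard)

end Literature.AnabelianGeometry.SemiGraphs
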